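import Mathlib
import HarnessLib
import Summits.HubbardSuperconductivity.HubbardSuperconductivity.Theorems.KLProgrammeKLRegimeEngineE4ScaleDoorFixed
import Summits.HubbardSuperconductivity.HubbardSuperconductivity.Theorems.KLProgrammeKLRegimeSplitSlotsV17F2

/-!
# (E4)ₙ at the inductive scales of the engine-flow child `KLRegimeEngineV17F2` (stmt-HubbardSuperconductivity-20437), stub (b) conjunct 3:
# the RESIDUAL «AnisoTupleWtL1At» and the closer modulo it

Cell gate-hubbard-kl, seat hubbard-kl-k3c3-p2 (g7); memo E4N-SUPPLY.md (evidence #18 on 20437).  The third conjunct of `stub_engine_step_norms`,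
`EngineFirstMoments L M G P Q β U μ (klFlowFrameU … n) n` (`1 ≤ n`), is consumed through p521997 `engineFirstMoments_of_wtSum_fixed`: one inequality per
anisotropic label 4-tuple `Ω`, the LEVEL-`n` weighted position sum of the sectorised quartic kernel `≤ klE0·((G.cE4 + Q.cE4|U|)·P.Klam·|U|)`.  That sum is
(per-tuple mass) + `Λ_n`·(first moment); it is `n`-uniformly of size `CF_w·(value bound) + CF_w′·(Klam U)²` by the local/remainder structure of the level-`n`
kernel (local part = the per-tuple VALUE smeared by the level-`n` sector functions, whose weighted torus sums are `n`-free; remainder = Taylor remainders of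
the increments born at `m ≤ n`, masses `≲ 4^{m−n}(Klam U)²`, a geometric sum) — i.e. by the WEIGHTED, ANISOTROPIC twin of the value-lane slot (E5-F)
`IsoTupleL1AtV17F` (same value input `B` on the bare ball).  This file names that twin and closes (E4)ₙ modulo it:

* §1 **`AnisoTupleWtL1At L M CFw CFw' P β U μ K n`** (residual W3 of the memo): for every value bound `B ≥ 0` of the `↑↓` quartic values
  `klQuarticValue … K n 0 1 k₁ k₂ k₃` on the bare ball `klBall L μ 0`, every aniso 4-tuple `Ω` has level-`n` weighted position sum
  `≤ CFw·klE0·B + CFw'·(P.Klam·U)²` — the shape of `IsoTupleL1AtV17F … n` at `m = n` with `fixedTupleL1` replaced by the `klScaleWt n`-weighted sum of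
  `…EngineE4ScaleDoorFixed` and the iso family by the aniso one (frame `K` generic; at `K := klFlowFrameU … n` for stub (b));
* §2 **`engineFirstMoments_of_anisoTupleWtL1At`** — W3 + a value bound `B` + the NUMERIC fit `CFw·klE0·B + CFw'·(Klam U)² ≤ klE0·((G.cE4 + Q.cE4|U|)·Klam·|U|)`
  ⇒ `EngineFirstMoments L M G P Q β U μ K n` (any `K`, `n`; one `le_trans` into p521997);
* §3 the value bound at `(K_n, n)` from the HISTORY's value line at `(K_{n−1}, n−1)` (child 1's `QuarticValueLineV17F … (n−1)`, inside `BetaSplitAtV17F (n−1)`)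
  and a uniform majorant `I` of the (E2′-F)ₙ increment: `quarticValue_flow_le_of_prev_of_increment` (`≤ P.Klam·|U| + I`), and
  `quarticValueLineV17F_of_histP` (extraction from `HistP klPredsV17F2 … n` at `j = n − 1`);
* §4 **`engineFirstMoments_flow_of_residuals`** — under the binders that matter (`1 ≤ n`, the history), from W3 at `K_n`, a uniform increment majorant `I`
  for (E2′-F)ₙ (stub (c)'s third conjunct, consumed at PROOF level — no skeleton token: the (b)-closer of conjunct 3 may import the landed (c) module) and the
  fit with `B := P.Klam·|U| + I` ⇒ `EngineFirstMoments L M G P Q β U μ (klFlowFrameU L M β U μ n) n`.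

What is NOT here (memo §2): W1 the weighted torus bound of the level-`n` aniso sector functions (sector lane), the analytic proof of W3 (engine/value lane:
(E5-F)ₙ's supplier run with the weight), the increment majorant `I` (value lane's bars: `gainBar + eremBar + thermalBar + legDressBarQ2 + frameShiftBar ≤ I`).
One definition (a residual predicate, nothing about the model is asserted) + bookkeeping theorems; nothing asserts superconductivity.
-/

noncomputable section

namespace Summit.HubbardSuperconductivity.HubbardSuperconductivity.Theorems.EngineV8

set_option linter.dupNamespace false -- summit = problem name (single-conjunct summit), D-0017

open Real Finset Literature.MathematicalPhysics.QuantumLattice Literature.Probability.LatticeModels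
open Literature.Probability.LatticeModels.BattleFederbush
open Literature.MathematicalPhysics.QuantumLattice.GrassmannAlgebra
open Summit.HubbardSuperconductivity.HubbardSuperconductivity.Theorems.KLRegimeSplit
open Summit.HubbardSuperconductivity.HubbardSuperconductivity.Theorems.KLProgrammeLegKernels
open Summit.HubbardSuperconductivity.HubbardSuperconductivity.Theorems.DispersionFlow

/-! ## §1 The residual W3: the weighted anisotropic tuple bound from a value bound -/

section Model

variable (L M : ℕ) [NeZero L] [NeZero M]

/-- **W3 «`AnisoTupleWtL1At`»** — the WEIGHTED, ANISOTROPIC twin of (E5-F) `IsoTupleL1AtV17F` at its own level: at frame `K` and scale `n`, every bound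
`B ≥ 0` of the `↑↓` quartic values `klQuarticValue … K n 0 1 k₁ k₂ k₃` on the bare ball `klBall L μ 0` gives, for EVERY anisotropic label 4-tuple `Ω`,
the level-`n` weighted position sum of the sectorised quartic kernel with leg `0` at the origin
`ε_x³·Σ_x klScaleWt_n(positions of (0,x))·‖klAnisoLegKernel … K klE0 n 4 Ω (0,x)‖ ≤ CFw·klE0·B + CFw'·(P.Klam·U)²`
(`CFw` = the weighted torus constant of the level-`n` aniso sector functions to the fourth, `CFw'` = the weighted remainder constant; both `n`-free reals). -/
def AnisoTupleWtL1At (CFw CFw' : ℝ) (P : SplitConsts) (β U μ : ℝ) (K : TrigPolyC4v) (n : ℕ) : Prop :=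
  ∀ B : ℝ, 0 ≤ B →
    (∀ k₁ ∈ klBall L μ 0, ∀ k₂ ∈ klBall L μ 0, ∀ k₃ ∈ klBall L μ 0, ‖klQuarticValue L M β U μ K n 0 1 k₁ k₂ k₃‖ ≤ B) →
      ∀ Ω : Fin 4 → SectorLeg (sectorCount n),
        imagTimeWeight β M ^ 3 *
            ∑ x : Fin 3 → SpaceTimeIdx L M,
              klScaleWt L M β n ((univ.image (fun j : Fin 4 => (Matrix.vecCons (0 : SpaceTimeIdx L M) x j, Ω j))).image
                  (latticeLegPos (2 * (2 * M)))) *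
                ‖klAnisoLegKernel L M β U μ K klE0 n 4 Ω (Matrix.vecCons (0 : SpaceTimeIdx L M) x)‖ ≤
          CFw * klE0 * B + CFw' * (P.Klam * U) ^ 2

end Model

/-! ## §2 (E4)ₙ from W3, a value bound and the numeric fit -/

section Generic

variable {L M : ℕ} [NeZero L] [NeZero M]

/-- **(E4) at `(K, n)` from the weighted aniso tuple bound**: W3 `AnisoTupleWtL1At … K n`, a value bound `B ≥ 0` on the bare ball, and the fit
`CFw·klE0·B + CFw'·(Klam U)² ≤ klE0·((G.cE4 + Q.cE4|U|)·Klam·|U|)` give `EngineFirstMoments L M G P Q β U μ K n` (`β > 0`; door p521997). -/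
theorem engineFirstMoments_of_anisoTupleWtL1At {β : ℝ} (hβ : 0 < β) {U μ : ℝ} {K : TrigPolyC4v} {n : ℕ} {CFw CFw' B : ℝ}
    {G : GeoConsts} {P : SplitConsts} {Q : EngConsts} (hW3 : AnisoTupleWtL1At L M CFw CFw' P β U μ K n) (hB0 : 0 ≤ B)
    (hvals : ∀ k₁ ∈ klBall L μ 0, ∀ k₂ ∈ klBall L μ 0, ∀ k₃ ∈ klBall L μ 0, ‖klQuarticValue L M β U μ K n 0 1 k₁ k₂ k₃‖ ≤ B)
    (hfit : CFw * klE0 * B + CFw' * (P.Klam * U) ^ 2 ≤ klE0 * ((G.cE4 + Q.cE4 * |U|) * P.Klam * |U|)) :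
    EngineFirstMoments L M G P Q β U μ K n :=
  engineFirstMoments_of_wtSum_fixed hβ fun Ω => (hW3 B hB0 hvals Ω).trans hfit

/-! ## §3 The value bound at `(K_n, n)` from the history's value line and an increment majorant -/

/-- **Values at `(K_n, n)` from the previous level's value line and a uniform increment majorant**: `QuarticValueLineV17F … (n−1)` (values at
`(K_{n−1}, n−1)` bounded by `Klam·|U|`) and `‖value(K_n,n) − value(K_{n−1},n−1)‖ ≤ I` on the bare ball give `‖value(K_n, n)‖ ≤ Klam·|U| + I`. -/
theorem quarticValue_flow_le_of_prev_of_increment {P : SplitConsts} {β U μ : ℝ} {n : ℕ} {I : ℝ}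
    (hprev : QuarticValueLineV17F L M P β U μ (n - 1))
    (hinc : ∀ k₁ ∈ klBall L μ 0, ∀ k₂ ∈ klBall L μ 0, ∀ k₃ ∈ klBall L μ 0,
      ‖klQuarticValue L M β U μ (klFlowFrameU L M β U μ n) n 0 1 k₁ k₂ k₃ -
          klQuarticValue L M β U μ (klFlowFrameU L M β U μ (n - 1)) (n - 1) 0 1 k₁ k₂ k₃‖ ≤ I) :
    ∀ k₁ ∈ klBall L μ 0, ∀ k₂ ∈ klBall L μ 0, ∀ k₃ ∈ klBall L μ 0,
      ‖klQuarticValue L M β U μ (klFlowFrameU L M β U μ n) n 0 1 k₁ k₂ k₃‖ ≤ P.Klam * |U| + I := by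
  intro k₁ hk₁ k₂ hk₂ k₃ hk₃
  have h1 := hprev k₁ hk₁ k₂ hk₂ k₃ hk₃
  have h2 := hinc k₁ hk₁ k₂ hk₂ k₃ hk₃
  calc ‖klQuarticValue L M β U μ (klFlowFrameU L M β U μ n) n 0 1 k₁ k₂ k₃‖
      = ‖klQuarticValue L M β U μ (klFlowFrameU L M β U μ (n - 1)) (n - 1) 0 1 k₁ k₂ k₃ +
          (klQuarticValue L M β U μ (klFlowFrameU L M β U μ n) n 0 1 k₁ k₂ k₃ -
            klQuarticValue L M β U μ (klFlowFrameU L M β U μ (n - 1)) (n - 1) 0 1 k₁ k₂ k₃)‖ := by rw [add_sub_cancel]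
    _ ≤ _ := (norm_add_le _ _).trans (add_le_add h1 h2)

/-- **A uniform increment majorant from (E2′-F)ₙ** (`QuarticValueIncrementAtV17F … n`, `1 ≤ n`): if its right-hand side is `≤ I` at every triple of
the bare ball, the values move by at most `I` from `(K_{n−1}, n−1)` to `(K_n, n)`. -/
theorem quarticValue_increment_le_of_quarticValueIncrementAtV17F {G : GeoConsts} {P : SplitConsts} {Q : EngConsts} {β U μ : ℝ} {n : ℕ} {I : ℝ}
    (hn : 1 ≤ n) (hE : QuarticValueIncrementAtV17F L M G P Q β U μ n)
    (hbar : ∀ k₁ ∈ klBall L μ 0, ∀ k₂ ∈ klBall L μ 0, ∀ k₃ ∈ klBall L μ 0,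
      gainBar G P U n (klTorusNorm L (k₁ + k₃)) (klTorusNorm L (k₁ - k₂)) (klTorusNorm L (k₂ - k₃)) +
          eremBar G P Q U β L (n - 1) + thermalBar G P U β n +
            legDressBarQ2 G P Q U n (legSliceCountT L β μ (klFlowFrameU L M β U μ n) n ![k₁, k₂, k₃, k₁ - k₂ + k₃]) +
              frameShiftBar P Q U n ≤ I) :
    ∀ k₁ ∈ klBall L μ 0, ∀ k₂ ∈ klBall L μ 0, ∀ k₃ ∈ klBall L μ 0,
      ‖klQuarticValue L M β U μ (klFlowFrameU L M β U μ n) n 0 1 k₁ k₂ k₃ -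
          klQuarticValue L M β U μ (klFlowFrameU L M β U μ (n - 1)) (n - 1) 0 1 k₁ k₂ k₃‖ ≤ I :=
  fun k₁ hk₁ k₂ hk₂ k₃ hk₃ => (hE hn k₁ hk₁ k₂ hk₂ k₃ hk₃).trans (hbar k₁ hk₁ k₂ hk₂ k₃ hk₃)

/-- **The previous level's value line from the history**: `HistP klPredsV17F2 … n` with `1 ≤ n` contains child 1's `BetaSplitAtV17F … (n−1)`, whose
second conjunct carries `QuarticValueLineV17F … (n−1)`. -/
theorem quarticValueLineV17F_of_histP {G : GeoConsts} {P : SplitConsts} {Q : EngConsts} {R : RenConsts} {β U μ : ℝ} {K : TrigPolyC4v} {n : ℕ}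
    (hn : 1 ≤ n) (hhist : HistP klPredsV17F2 L M G P Q R β U μ K n) : QuarticValueLineV17F L M P β U μ (n - 1) :=
  (((histP_klPredsV17F2_iff (L := L) (M := M) (G := G) (P := P) (Q := Q) (R := R) (β := β) (U := U) (μ := μ) (K := K) (n := n)).1 hhist
    (n - 1) (by omega)).1).2.1.2

/-! ## §4 (E4)ₙ at the flow frame modulo the residuals (stub (b) conjunct 3) -/

/-- **(E4)ₙ AT THE FLOW FRAME, MODULO THE RESIDUALS.**  At an inductive scale `1 ≤ n` with the history `HistP klPredsV17F2 … n` (binders of stub (b)):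
W3 `AnisoTupleWtL1At … (K_n) n`, (E2′-F)ₙ with a uniform majorant `I ≥ 0` of its right-hand side on the bare ball (stub (c)'s third conjunct, read at
proof level), and the numeric fit `CFw·klE0·(Klam·|U| + I) + CFw'·(Klam U)² ≤ klE0·((G.cE4 + Q.cE4|U|)·Klam·|U|)` give
`EngineFirstMoments L M G P Q β U μ (klFlowFrameU L M β U μ n) n` (`β > 0`, `0 ≤ Klam`). -/
theorem engineFirstMoments_flow_of_residuals {G : GeoConsts} {P : SplitConsts} {Q : EngConsts} {R : RenConsts} {β U μ : ℝ} (hβ : 0 < β)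
    (hKlam : 0 ≤ P.Klam) {K : TrigPolyC4v} {n : ℕ} (hn : 1 ≤ n) (hhist : HistP klPredsV17F2 L M G P Q R β U μ K n) {CFw CFw' I : ℝ} (hI : 0 ≤ I)
    (hW3 : AnisoTupleWtL1At L M CFw CFw' P β U μ (klFlowFrameU L M β U μ n) n)
    (hE : QuarticValueIncrementAtV17F L M G P Q β U μ n)
    (hbar : ∀ k₁ ∈ klBall L μ 0, ∀ k₂ ∈ klBall L μ 0, ∀ k₃ ∈ klBall L μ 0,
      gainBar G P U n (klTorusNorm L (k₁ + k₃)) (klTorusNorm L (k₁ - k₂)) (klTorusNorm L (k₂ - k₃)) +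
          eremBar G P Q U β L (n - 1) + thermalBar G P U β n +
            legDressBarQ2 G P Q U n (legSliceCountT L β μ (klFlowFrameU L M β U μ n) n ![k₁, k₂, k₃, k₁ - k₂ + k₃]) +
              frameShiftBar P Q U n ≤ I)
    (hfit : CFw * klE0 * (P.Klam * |U| + I) + CFw' * (P.Klam * U) ^ 2 ≤ klE0 * ((G.cE4 + Q.cE4 * |U|) * P.Klam * |U|)) :
    EngineFirstMoments L M G P Q β U μ (klFlowFrameU L M β U μ n) n :=
  engineFirstMoments_of_anisoTupleWtL1At hβ hW3 (add_nonneg (mul_nonneg hKlam (abs_nonneg U)) hI)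
    (quarticValue_flow_le_of_prev_of_increment (quarticValueLineV17F_of_histP hn hhist)
      (quarticValue_increment_le_of_quarticValueIncrementAtV17F hn hE hbar)) hfit

end Generic

end Summit.HubbardSuperconductivity.HubbardSuperconductivity.Theorems.EngineV8

end
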